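import Literature.Computability.MetaComplexity.MCSP
import Literature.Computability.MetaComplexity.TruthTablesProofs
import Literature.Computability.Complexity.IsqrtBrick
import Literature.Computability.Complexity.StringEquality
import Literature.Computability.Complexity.OracleProofs
import Literature.Computability.Complexity.PRelHierarchy
import Literature.Computability.Complexity.CircuitCounting
import HarnessLib

/-!
# The dense `MCSP` statistical test `{T : (T, √|T|) ∉ MCSP}` (proofs)

Part of the proof architecture of the named fact `AllenderEtAl2006_MCSP_universalInverter`
(`MCSPUniversalInverter.lean`; Allender–Buhrman–Koucký–van Melkebeek–Ronneburger 2006, Thm. 45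
with §4.2). Theorem 45 is printed for an oracle `L` "of polynomial density such that, for some
`ε > 0`, for every `x ∈ L`, `KT(x) ≥ |x|^ε`", and is carried over to `MCSP` by the remark that
"other examples of such sets can be found in `P^{MCSP}`" (ABK⁺06 §4.2, p. 24 of the author
version); Allender–Das 2017 (remark after Thm. 1) name the example
"`L = {f : f is a Boolean function on n variables, and (f, 2^{n/2}) ∉ MCSP}`". This file provides
that example in the tree's vocabulary — as the COMPLEMENT of the parametrised problem
`MCSPSize θ = MCSP[θ]` at the threshold `θ(n) = ⌊√(2ⁿ)⌋` (`= 2^{n/2}` for even `n`) — and proves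
the three properties the proof of Thm. 45 uses (p. 24: "`L` is a statistical test that accepts
many random strings of length `|x|^{O(1)}`, but rejects all pseudorandom strings"):

* `MCSPSize_sqrt_karpReducible_MCSP` — `MCSP[√·] ≤ₚ MCSP` by `T ↦ ⟨T, bin ⌊√|T|⌋⟩` (the brick
  `isqrtFn`, `IsqrtBrick.lean`); hence `MCSPSize_sqrt_mem_PRel`, **`compl_MCSPSize_sqrt_mem_PRel`**:
  the test is in `P^{MCSP}` (Karp ⇒ Cook, `PolyTimeKarpReducible.turing_holds`; `P^O` is closed
  under complement, `compl_mem_PRel`);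
* `truthTable_mem_compl_MCSPSize_iff` — usefulness: a truth table passes the test iff its
  function has `B₂`-circuit complexity `> ⌊√(2ⁿ)⌋` (so the test rejects every truth table of small
  circuit complexity);
* `card_filter_circuitSizeOver_le`, `two_mul_circuitCount_le`, **`card_compl_MCSPSize_sqrt_ge`** —
  largeness: for even `n = 2j ≥ 10` at least half of all `n`-variable Boolean functions pass the
  test (counting small circuits, `CircuitCount.card_computable_le'`: at most
  `(s+1)(16(n+s+1)²)ˢ(n+s+1) ≤ 2^{(2j+7)2ʲ} ≤ 2^{2ⁿ}/2` functions have circuits of size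
  `≤ s = 2ʲ`).

Theorems only; no new definitions (the test is `(MCSPSize fun n => Nat.sqrt (2 ^ n))ᶜ`).

## References

* E. Allender, H. Buhrman, M. Koucký, D. van Melkebeek, D. Ronneburger, *Power from random
  strings*, SIAM J. Comput. 35(6) (2006) [AllenderEtAl2006]: Thm. 45 and its proof, §4.2 first
  paragraph (pp. 23–24 of the author version).
* E. Allender, B. Das, *Zero knowledge and circuit minimization*, Inform. and Comput. 256 (2017)
  [AllenderDas2017]: remark after Thm. 1.
* V. Kabanets, J.-Y. Cai, *Circuit minimization problem*, STOC 2000 [KabanetsCai2000], §2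
  (`MCSP`, `MCSP[s]`), Thm. (natural properties from `MCSP ∈ P`).
* S. Arora, B. Barak, *Computational Complexity: A Modern Approach*, CUP 2009 [AroraBarak2009],
  Thm. 6.21 (counting circuits).
-/

namespace Literature.Computability.MetaComplexity

open _root_.Computability Complexity Complexity.Brick Finset

/-! ### The test is in `P^{MCSP}` -/

/-- **`MCSP[⌊√(2ⁿ)⌋] ≤ₚ MCSP`** by the map `T ↦ ⟨T, bin ⌊√|T|⌋⟩` (`fanoutFn id isqrtFn`, in `FP`
by `isqrtFn_mem_FP`): a string of length `2ⁿ` is a truth table `tt f`, mapped to the `MCSP`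
instance `⟨tt f, bin ⌊√(2ⁿ)⌋⟩`; a string whose length is not a power of two is in neither
language (the first component of an `MCSP` instance is a truth table).
[cite: AllenderDas2017, remark after Thm. 1] [cite: KabanetsCai2000, §2] -/
theorem MCSPSize_sqrt_karpReducible_MCSP :
    PolyTimeKarpReducible (MCSPSize fun n => Nat.sqrt (2 ^ n)) MCSP := by
  refine polyTimeKarpReducible_iff.2
    ⟨fanoutFn id isqrtFn, fanoutFn_mem_FP (PolyTimeComputable.id _) isqrtFn_mem_FP, fun w => ?_⟩
  rw [fanoutFn_apply, isqrtFn_apply, id]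
  constructor
  · rintro ⟨n, f, rfl, hf⟩
    rw [length_truthTable]
    exact (boolPair_truthTable_mem_MCSP_iff f _).2 hf
  · rintro ⟨n, f, s, hw, hf⟩
    have h := congrArg boolUnpair hw
    simp only [boolUnpair_boolPair, Prod.mk.injEq] at h
    obtain ⟨rfl, hs⟩ := h
    have hs' : Nat.sqrt (2 ^ n) = s := by
      simpa [length_truthTable] using congrArg decodeNat hs
    refine ⟨n, f, rfl, ?_⟩
    show circuitSizeOver B2 f ≤ Nat.sqrt (2 ^ n)
    rw [hs']
    exact hf

/-- `MCSP[⌊√(2ⁿ)⌋] ∈ P^{MCSP}` (Karp reducibility implies Cook reducibility).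
[cite: AllenderDas2017, remark after Thm. 1] -/
theorem MCSPSize_sqrt_mem_PRel :
    (MCSPSize fun n => Nat.sqrt (2 ^ n)) ∈ PRel (Oracle.ofLanguage MCSP) :=
  PolyTimeKarpReducible.turing_holds MCSPSize_sqrt_karpReducible_MCSP

/-- **The statistical test `{T : (T, ⌊√|T|⌋) ∉ MCSP}` is in `P^{MCSP}`** ("such a set `L` can be
recognized in deterministic polynomial time with an oracle for `MCSP`", Allender–Das; `P^O` is
closed under complement). [cite: AllenderDas2017, remark after Thm. 1]
[cite: AllenderEtAl2006, §4.2 (p. 24, "other examples of such sets can be found in P^MCSP")] -/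
theorem compl_MCSPSize_sqrt_mem_PRel :
    (MCSPSize fun n => Nat.sqrt (2 ^ n))ᶜ ∈ PRel (Oracle.ofLanguage MCSP) :=
  compl_mem_PRel MCSPSize_sqrt_mem_PRel

/-! ### Usefulness: the test rejects every function of small circuit complexity -/

/-- **Usefulness of the test.** A truth table `tt f` of an `n`-variable function passes the test
(lies outside `MCSP[⌊√(2ⁿ)⌋]`) iff `circuitSizeOver B2 f > ⌊√(2ⁿ)⌋`; in particular the test
rejects the truth table of every function of circuit complexity `≤ ⌊√(2ⁿ)⌋` (ABK⁺06, proof of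
Thm. 45: "rejects all pseudorandom strings"). [cite: AllenderEtAl2006, Thm. 45 (proof, p. 24)]
[cite: KabanetsCai2000, §2] -/
theorem truthTable_mem_compl_MCSPSize_iff {n : ℕ} (θ : ℕ → ℕ) (f : (Fin n → Bool) → Bool) :
    truthTable f ∈ (MCSPSize θ)ᶜ ↔ θ n < circuitSizeOver B2 f := by
  change ¬ truthTable f ∈ MCSPSize θ ↔ _
  rw [truthTable_mem_MCSPSize_iff, not_le]

/-- A string of length `2ⁿ` passes the test iff the function it tabulates has circuit complexity
`> θ n`. [cite: KabanetsCai2000, §2] -/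
theorem mem_compl_MCSPSize_iff_of_length_eq {n : ℕ} (θ : ℕ → ℕ) (w : List Bool)
    (hw : w.length = 2 ^ n) : w ∈ (MCSPSize θ)ᶜ ↔ θ n < circuitSizeOver B2 (ofTruthTable w hw) := by
  rw [← truthTable_mem_compl_MCSPSize_iff θ, truthTable_ofTruthTable]

/-! ### Largeness: at least half of all functions pass the test -/

/-- **Few functions have small circuits**: at most `(s+1)(16(n+s+1)²)ˢ(n+s+1)` Boolean functions
on `n` variables have `B₂`-circuit complexity `≤ s` (`CircuitCount.card_computable_le'`; the
infimum `circuitSizeOver B2 f` is attained, `exists_computes_B2_size_eq_holds`).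
[cite: AroraBarak2009, Thm. 6.21 (proof: counting circuits)] -/
theorem card_filter_circuitSizeOver_le (n s : ℕ) :
    #{f : (Fin n → Bool) → Bool | circuitSizeOver B2 f ≤ s} ≤
      (s + 1) * (16 * (n + s + 1) ^ 2) ^ s * (n + s + 1) := by
  classical
  refine le_trans (Finset.card_le_card fun f hf => ?_) (CircuitCount.card_computable_le' n s)
  simp only [Finset.mem_filter, Finset.mem_univ, true_and] at hf ⊢
  obtain ⟨C, hB, hC, hsize⟩ := exists_computes_B2_size_eq_holds f
  exact ⟨C, hB, hsize ▸ hf, hC⟩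

/-- `2j + 7 ≤ 2ʲ` for `j ≥ 5`. [folklore] -/
private theorem two_mul_add_seven_le_two_pow {j : ℕ} (hj : 5 ≤ j) : 2 * j + 7 ≤ 2 ^ j := by
  induction j, hj using Nat.le_induction with
  | base => norm_num
  | succ k hk ih => rw [pow_succ]; omega

/-- **The circuit count is at most half of all functions** at the threshold `s = 2ʲ` on `n = 2j`
variables, `j ≥ 5`: `2 · (s+1)(16(n+s+1)²)ˢ(n+s+1) ≤ 2^{2ⁿ}` (crude estimates
`n + s + 1 ≤ 2^{j+1}`, `16(n+s+1)² ≤ 2^{2j+6}`, exponent `(2j+6)2ʲ + 2j + 3 ≤ (2j+7)2ʲ ≤ 4ʲ`).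
[cite: AroraBarak2009, Thm. 6.21] -/
theorem two_mul_circuitCount_le {j : ℕ} (hj : 5 ≤ j) :
    2 * ((2 ^ j + 1) * (16 * (2 * j + 2 ^ j + 1) ^ 2) ^ 2 ^ j * (2 * j + 2 ^ j + 1)) ≤
      2 ^ 2 ^ (2 * j) := by
  have h7 := two_mul_add_seven_le_two_pow hj
  -- `t = n + s + 1 ≤ 2^{j+1}`
  have ht : 2 * j + 2 ^ j + 1 ≤ 2 ^ (j + 1) := by rw [pow_succ]; omega
  have hs : 2 ^ j + 1 ≤ 2 ^ (j + 1) := by rw [pow_succ]; omega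
  -- `16 t² ≤ 2^{2j+6}`
  have h16 : 16 * (2 * j + 2 ^ j + 1) ^ 2 ≤ 2 ^ (2 * j + 6) := by
    calc 16 * (2 * j + 2 ^ j + 1) ^ 2 ≤ 16 * (2 ^ (j + 1)) ^ 2 :=
          Nat.mul_le_mul_left _ (Nat.pow_le_pow_left ht 2)
      _ = 2 ^ (2 * j + 6) := by
          rw [← pow_mul, show (16 : ℕ) = 2 ^ 4 by norm_num, ← pow_add]
          congr 1; ring
  have hpow : (16 * (2 * j + 2 ^ j + 1) ^ 2) ^ 2 ^ j ≤ 2 ^ ((2 * j + 6) * 2 ^ j) := by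
    calc (16 * (2 * j + 2 ^ j + 1) ^ 2) ^ 2 ^ j ≤ (2 ^ (2 * j + 6)) ^ 2 ^ j :=
          Nat.pow_le_pow_left h16 _
      _ = 2 ^ ((2 * j + 6) * 2 ^ j) := by rw [← pow_mul]
  -- the exponent bound
  have hexp : 1 + (j + 1) + (2 * j + 6) * 2 ^ j + (j + 1) ≤ 2 ^ (2 * j) := by
    have h3 : 2 * j + 3 ≤ 2 ^ j := by omega
    calc 1 + (j + 1) + (2 * j + 6) * 2 ^ j + (j + 1) = (2 * j + 6) * 2 ^ j + (2 * j + 3) := by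
          ring
      _ ≤ (2 * j + 6) * 2 ^ j + 2 ^ j := Nat.add_le_add_left h3 _
      _ = (2 * j + 7) * 2 ^ j := by ring
      _ ≤ 2 ^ j * 2 ^ j := Nat.mul_le_mul_right _ h7
      _ = 2 ^ (2 * j) := by rw [← pow_add]; congr 1; ring
  calc 2 * ((2 ^ j + 1) * (16 * (2 * j + 2 ^ j + 1) ^ 2) ^ 2 ^ j * (2 * j + 2 ^ j + 1))
      ≤ 2 ^ 1 * (2 ^ (j + 1) * 2 ^ ((2 * j + 6) * 2 ^ j) * 2 ^ (j + 1)) := by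
        rw [pow_one]
        exact Nat.mul_le_mul_left 2
          (Nat.mul_le_mul (Nat.mul_le_mul hs hpow) ht)
    _ = 2 ^ (1 + (j + 1) + (2 * j + 6) * 2 ^ j + (j + 1)) := by
        simp only [pow_add]; ring
    _ ≤ 2 ^ 2 ^ (2 * j) := Nat.pow_le_pow_right (by norm_num) hexp

/-- `⌊√(2^{2j})⌋ = 2ʲ`. [folklore] -/
theorem sqrt_two_pow_two_mul (j : ℕ) : Nat.sqrt (2 ^ (2 * j)) = 2 ^ j := by
  rw [pow_mul', Nat.sqrt_eq']

/-- **At most half of all functions fail the test** (`n = 2j ≥ 10` variables):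
`2 · #{f | circuitSizeOver B2 f ≤ ⌊√(2ⁿ)⌋} ≤ 2^{2ⁿ}`. [cite: AllenderEtAl2006, Thm. 45 (proof, p. 24: "accepts many random strings")]
[cite: AroraBarak2009, Thm. 6.21] -/
theorem two_mul_card_filter_circuitSizeOver_le_sqrt {j : ℕ} (hj : 5 ≤ j) :
    2 * #{f : (Fin (2 * j) → Bool) → Bool | circuitSizeOver B2 f ≤ Nat.sqrt (2 ^ (2 * j))} ≤
      2 ^ 2 ^ (2 * j) := by
  rw [sqrt_two_pow_two_mul]
  refine le_trans (Nat.mul_le_mul_left 2 (card_filter_circuitSizeOver_le (2 * j) (2 ^ j))) ?_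
  exact two_mul_circuitCount_le hj

open scoped Classical in
/-- **Largeness of the test**: for `n = 2j ≥ 10`, at least half of the `2^{2ⁿ}` Boolean
functions on `n` variables have truth tables passing the test
(`2^{2ⁿ} ≤ 2 · #{f | tt f ∉ MCSP[⌊√(2ⁿ)⌋]}`; ABK⁺06, proof of Thm. 45: "`L` is a statistical test
that accepts many random strings"). [cite: AllenderEtAl2006, Thm. 45 (proof, p. 24)]
[cite: AroraBarak2009, Thm. 6.21] -/
theorem card_compl_MCSPSize_sqrt_ge {j : ℕ} (hj : 5 ≤ j) :
    2 ^ 2 ^ (2 * j) ≤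
      2 * #{f : (Fin (2 * j) → Bool) → Bool |
        truthTable f ∈ (MCSPSize fun n => Nat.sqrt (2 ^ n))ᶜ} := by
  have hsmall := two_mul_card_filter_circuitSizeOver_le_sqrt hj
  -- the passing functions are exactly those of large circuit complexity
  have heq : #{f : (Fin (2 * j) → Bool) → Bool |
      truthTable f ∈ (MCSPSize fun n => Nat.sqrt (2 ^ n))ᶜ} =
        #{f : (Fin (2 * j) → Bool) → Bool | ¬ circuitSizeOver B2 f ≤ Nat.sqrt (2 ^ (2 * j))} := by
    congr 1
    ext f
    simp only [Finset.mem_filter, Finset.mem_univ, true_and,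
      truthTable_mem_compl_MCSPSize_iff, not_le]
  have hsum := Finset.card_filter_add_card_filter_not
    (s := (Finset.univ : Finset ((Fin (2 * j) → Bool) → Bool)))
    (fun f => circuitSizeOver B2 f ≤ Nat.sqrt (2 ^ (2 * j)))
  have hcard : (Finset.univ : Finset ((Fin (2 * j) → Bool) → Bool)).card = 2 ^ 2 ^ (2 * j) := by
    simp
  rw [heq]
  omega

open scoped Classical in
/-- Largeness, real-density form (the hypothesis `B · 2^{2ⁿ} ≤ #{accepted}` of the hybrid argument
with `B = 1/2`). [cite: AllenderEtAl2006, Thm. 45 (proof, p. 24)] -/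
theorem half_mul_le_card_compl_MCSPSize_sqrt {j : ℕ} (hj : 5 ≤ j) :
    (1 / 2 : ℝ) * 2 ^ 2 ^ (2 * j) ≤
      (#{f : (Fin (2 * j) → Bool) → Bool |
        truthTable f ∈ (MCSPSize fun n => Nat.sqrt (2 ^ n))ᶜ} : ℝ) := by
  have h := card_compl_MCSPSize_sqrt_ge hj
  have h' : ((2 ^ 2 ^ (2 * j) : ℕ) : ℝ) ≤
      ((2 * #{f : (Fin (2 * j) → Bool) → Bool |
        truthTable f ∈ (MCSPSize fun n => Nat.sqrt (2 ^ n))ᶜ} : ℕ) : ℝ) := by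
    exact_mod_cast h
  push_cast at h'
  linarith

end Literature.Computability.MetaComplexity
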